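import Literature.MathematicalPhysics.QuantumFieldTheory.Balaban1983to89.B3Ineq314Cubes
import Literature.MathematicalPhysics.QuantumFieldTheory.Balaban1983to89.B3Ineq326CurlyLocal

/-!
# `Balaban1983to89.B3Ineq326CurlyCubes` — T. Bałaban, *(Higgs)₂,₃ quantum fields in a finite volume. III. Renormalization*, Commun. Math.
Phys. **88** (1983) 411–445 [Balaban1983Higgs3], p. 440 [PDF 30]: the last curly bracket of **(3.26)** *"analyzed as in (3.13), (3.14)"* IN THE
PRINTED, CUBE-LOCALIZED FORM of (3.13)/(3.14) p. 436 (`Σ_{Δ(v),Δ(v′)} sup_{x∈Δ(v)} … (L^{j₁}η)^{2d} …`), PROVED from p20 g3/g4's pointwise theorems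
by the cube partition of the sibling `B3Ineq314Cubes`

statement-level skeleton of published theorems with citation tags; proofs where landed; nothing here is a claim about the Yang–Mills mass gap

PDF held: `paper:balaban1983-higgs-2-3-quantum-fields-finite-volume` (journal page = PDF page + 410); p. 440 [PDF 30] and p. 436 [PDF 26] read
on the renders `run/shared/lean/pub/pub-balaban/b2b-balaban-ref1/pages/1983-cmp88-higgs23-III/1983-cmp88-higgs23-III-p030-x2.png` / `…-p026-x2.png`.

CITATION HEADER (lean-in-tree rule).  Part of the lit-balaban TYPED SKELETON (HOME `run/shared/lean/pub/lit-balaban/`), PHASE 2, seat p20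
generation 5; companion of `B3Ineq326Curly` (p20 g3: `abs_curly2_le`, the (3.13)-type pointwise bound of r15's `B3Sect3VectorSelfEnergy.curly2`),
`B3Ineq326CurlyLocal` (p20 g4: `abs_curly2_le_local`, the (3.14)-type localized leg bound) and `B3Ineq314Cubes` (p20 g5: the torus cubes
`cubeIdx`/`cubes`/`fiber`/`cdist`, `supOn`, and the localization step `sum_sum_le_cubes`).  WHAT IS REPRODUCED: row **B3.Eq3.25-3.32** of
`HOME/lit-balaban-r15/ROWS-B3.md` (fold owner r15), the p. 440 sentence on the last curly bracket of (3.26), cube-localized.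

THE PRINTED TEXT (verbatim).  p. 440 [PDF 30]: *"The expressions in the last curly bracket above are the generalized expressions of the same
form as in (3.11), they have positive degree −d+3+α and can be analyzed as in (3.13), (3.14), and Proposition 2.2 can be applied."*  p. 436
[PDF 26]: *"We localize additionally the vertices in cubes Δ(v), Δ(v′), |Δ(v)| = |Δ(v′)| = (L^{j₁}η)^d, j₁ = min{j, j′}, and we have (the expression
(3.12)) ≦ O(1) Σ_{Δ(v),Δ(v′)} sup_{x∈Δ(v)}|φ(x)| (L^{j₁}η)^{2d} (L^jη)^{−d} e^{−δ₀(L^jη)^{−1}dist(Δ(v),Δ(v′))} (L^{j′}η)^{−d+2} e^{−δ₀(L^{j′}η)^{−1}dist(Δ(v),Δ(v′))}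
… (3.13) … (the expression (3.12)) ≦ O(1) Σ_{Δ(v),Δ(v′)} sup_{x∈Δ(v)}|φ(x)| (L^{j₁}η)^{2d} … (L^{j₁}η)^{1+α}(L^{j″}η)^{−d+1−α}
exp[−½δ₀(L^{j″}η)^{−1}dist(Δ(v),Δ(v″))] (3.14)"*.

WHAT IS PROVED, and how.  `abs_curly2_le_cubes`: p20 g3's `abs_curly2_le` followed by `B3Ineq314Cubes.sum_sum_le_cubes` — for every cube side
`M ≥ 1` (the print: `M = L^{j₁}`), `|curly2| ≤ 2d|τ|H(2/δ+8/δ²)(C₁C₂s^{1−d}s′^{1−d} + C₃C₄s^{2−d}s′^{−d})(m·m^α)·Σ_{Δ,Δ′}(Mη)^{2d} sup_{x∈Δ}(Σ_μ|A_μ(x)|)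
e^{−½δ·η dist(Δ,Δ′)/s}e^{−½δ·η dist(Δ,Δ′)/s′}`; `abs_curly2_le_local_cubes`: p20 g4's `abs_curly2_le_local` localized the same way, with the third
factor `e^{−½δ·η dist(Δ,Δ″)/s″}` of (3.14), `Δ″` the cube (any side `M″`) of the second leg `x″` of the legs' propagator.  The external vector
leg enters through `sup_{x∈Δ(v)} Σ_μ|A_μ(x)|`; the kernel bounds remain HYPOTHESES (rows B3.Eq2.10–2.12).  D-0026: theorems only, no `def`,
no named fact; standard axioms.  Unit `lit-balaban-p20` (literature-prover-lit-balaban-p20-g5-0), 2026-08-21.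
-/

open scoped BigOperators

namespace Literature.MathematicalPhysics.QuantumFieldTheory.Balaban1983to89.B3Ineq326CurlyCubes

open LatticeFieldCalculus B3Sect3ScalarSelfEnergy B3Sect3VectorSelfEnergy B3Taylor310Remainder B3Ineq313Pointwise B3Ineq314Local
  B3Ineq326Curly B3Ineq326CurlyLocal B3Ineq314Cubes

noncomputable section

/-! ## The last curly bracket of (3.26), *"analyzed as in (3.13), (3.14)"*, cube-localized -/

section Curly326

variable {P : Params} {j : ℕ}

/-- **p. 440 [PDF 30]**, the last curly bracket of (3.26) *"analyzed as in (3.13), (3.14)"* — the (3.13) half in CUBE-LOCALIZED form, PROVED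
(every cube side `M ≥ 1`): p20 g3's pointwise `B3Ineq326Curly.abs_curly2_le` followed by the localization step,
`|curly2| ≤ 2d|τ|H(2/δ+8/δ²)(C₁C₂s^{1−d}s′^{1−d} + C₃C₄s^{2−d}s′^{−d})(m·m^α)·Σ_{Δ,Δ′}(Mη)^{2d} sup_{x∈Δ}(Σ_μ|A_μ(x)|)·e^{−½δ·η dist(Δ,Δ′)/s}
e^{−½δ·η dist(Δ,Δ′)/s′}`. [cite: Balaban1983Higgs3, (3.26) p.440] -/
theorem abs_curly2_le_cubes (η : ℝ) (hη : 0 < η) {α H τ C₁ C₂ C₃ C₄ δ s s' : ℝ} (hα0 : 0 ≤ α) (hα1 : α ≤ 1) (hH : 0 ≤ H)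
    (hδ : 0 < δ) (hs : 0 < s) (hs' : 0 < s') (Gj Gj' : Kernel P j) (g : SiteField P j ℝ) (hg : ∀ x, |g x| ≤ 1)
    (A : VecField P j ℝ) (g' : SiteField P j ℝ) (A' : VecField P j ℝ)
    (hA : ∀ (μ' : Fin P.d) (x x' : Site P j),
      |dAdjKernel η⁻¹ μ' Gj x x'| ≤ C₁ * s ^ (1 - (P.d : ℝ)) * Real.exp (-(δ * s⁻¹ * (η * Site.tdist x x'))))
    (hA' : ∀ (μ : Fin P.d) (x x' : Site P j),
      |dAdjKernel η⁻¹ μ Gj' x' x| ≤ C₂ * s' ^ (1 - (P.d : ℝ)) * Real.exp (-(δ * s'⁻¹ * (η * Site.tdist x x'))))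
    (hB : ∀ x x' : Site P j, |Gj x x'| ≤ C₃ * s ^ (2 - (P.d : ℝ)) * Real.exp (-(δ * s⁻¹ * (η * Site.tdist x x'))))
    (hB' : ∀ (μ μ' : Fin P.d) (x x' : Site P j),
      |d2Kernel η⁻¹ μ' μ Gj' x' x| ≤ C₄ * s' ^ (-(P.d : ℝ)) * Real.exp (-(δ * s'⁻¹ * (η * Site.tdist x x'))))
    (hφ' : ∀ μ' : Fin P.d, HolderDeriv η⁻¹ α H (legFn g' A' μ')) {M : ℕ} (hM : 0 < M) :
    |curly2 η τ Gj Gj' g A (fun μ' x x' => remFwd η⁻¹ (legFn g' A' μ') x x')| ≤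
      2 * P.d * |τ| * H * (2 / δ + 8 / δ ^ 2) *
        (C₁ * C₂ * (s ^ (1 - (P.d : ℝ)) * s' ^ (1 - (P.d : ℝ))) + C₃ * C₄ * (s ^ (2 - (P.d : ℝ)) * s' ^ (-(P.d : ℝ)))) *
        (min s s' * (min s s') ^ α) *
        ∑ c ∈ cubes P j M, ∑ c' ∈ cubes P j M, ((M : ℝ) * η) ^ (2 * P.d) *
          (supOn (fiber M c : Finset (Site P j)) (fun x => ∑ μ : Fin P.d, |A ⟨x, μ⟩|) *
            (Real.exp (-(δ / 2 * s⁻¹ * (η * (cdist P j M M c c' : ℝ)))) *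
              Real.exp (-(δ / 2 * s'⁻¹ * (η * (cdist P j M M c c' : ℝ)))))) := by
  have hpt := abs_curly2_le η hη hα0 hα1 hH hδ hs hs' Gj Gj' g hg A g' A' hA hA' hB hB' hφ' (τ := τ)
  -- the kernel constant is nonnegative (forced by the hypotheses at one pair of points)
  have hKc0 : 0 ≤ |τ| * (C₁ * C₂ * (s ^ (1 - (P.d : ℝ)) * s' ^ (1 - (P.d : ℝ))) +
      C₃ * C₄ * (s ^ (2 - (P.d : ℝ)) * s' ^ (-(P.d : ℝ)))) := by
    have h := (abs_nonneg _).trans (abs_kerC_le (τ := τ) hA hA' hB hB' ⟨0, P.hd⟩ ⟨0, P.hd⟩ default default)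
    exact nonneg_of_mul_nonneg_left h (mul_pos (Real.exp_pos _) (Real.exp_pos _))
  have hm : 0 < min s s' := lt_min hs hs'
  have hK : 0 ≤ 2 * P.d * |τ| * H * (2 / δ + 8 / δ ^ 2) *
      (C₁ * C₂ * (s ^ (1 - (P.d : ℝ)) * s' ^ (1 - (P.d : ℝ))) + C₃ * C₄ * (s ^ (2 - (P.d : ℝ)) * s' ^ (-(P.d : ℝ)))) *
      (min s s' * (min s s') ^ α) := by
    have h1 : 0 ≤ 2 * (P.d : ℝ) * H * (2 / δ + 8 / δ ^ 2) * (min s s' * (min s s') ^ α) := by positivity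
    calc (0 : ℝ) ≤ (2 * P.d * H * (2 / δ + 8 / δ ^ 2) * (min s s' * (min s s') ^ α)) *
        (|τ| * (C₁ * C₂ * (s ^ (1 - (P.d : ℝ)) * s' ^ (1 - (P.d : ℝ))) + C₃ * C₄ * (s ^ (2 - (P.d : ℝ)) * s' ^ (-(P.d : ℝ))))) :=
          mul_nonneg h1 hKc0
      _ = _ := by ring
  have hloc := sum_sum_le_cubes hM hη.le (fun x => ∑ μ : Fin P.d, |A ⟨x, μ⟩|)
    (fun x => Finset.sum_nonneg fun μ _ => abs_nonneg _)
    (fun x x' => Real.exp (-(δ / 2 * s⁻¹ * (η * Site.tdist x x'))) * Real.exp (-(δ / 2 * s'⁻¹ * (η * Site.tdist x x'))))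
    (fun x x' => by positivity)
    (fun c c' => Real.exp (-(δ / 2 * s⁻¹ * (η * (cdist P j M M c c' : ℝ)))) *
      Real.exp (-(δ / 2 * s'⁻¹ * (η * (cdist P j M M c c' : ℝ)))))
    (fun x x' => mul_le_mul (exp_tdist_le_exp_cdist (by positivity) hη.le M M x x')
      (exp_tdist_le_exp_cdist (by positivity) hη.le M M x x') (by positivity) (by positivity))
  exact hpt.trans (mul_le_mul_of_nonneg_left hloc hK)

/-- **p. 440 [PDF 30]**, the last curly bracket of (3.26) *"analyzed as in (3.13), (3.14)"* — the (3.14) half in CUBE-LOCALIZED form AS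
PRINTED, PROVED (cube sides `M ≥ 1` for `Δ(v), Δ(v′)` and `M″` for `Δ(v″)`): p20 g4's pointwise `B3Ineq326CurlyLocal.abs_curly2_le_local`
(localized (2.11)-type bound of the leg functions around the second leg `x″` of their propagator, `s″ = L^{j″}η ≥ max(s,s′)`, `η ≤ s″`)
followed by the localization step: `|curly2| ≤ 8d|τ|C₅e^{δ/2}(2/δ+8/δ²)(C₁C₂s^{1−d}s′^{1−d} + C₃C₄s^{2−d}s′^{−d})(m·m^α)·Σ_{Δ,Δ′}(Mη)^{2d}
sup_{x∈Δ}(Σ_μ|A_μ(x)|)·e^{−½δ·η dist(Δ,Δ′)/s}e^{−½δ·η dist(Δ,Δ′)/s′}e^{−½δ·η dist(Δ,Δ″)/s″}`. [cite: Balaban1983Higgs3, (3.26) p.440] -/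
theorem abs_curly2_le_local_cubes (η : ℝ) (hη : 0 < η) {α τ C₁ C₂ C₃ C₄ C₅ δ s s' s'' : ℝ} (hα0 : 0 ≤ α) (hα1 : α ≤ 1)
    (hC₅ : 0 ≤ C₅) (hδ : 0 < δ) (hs : 0 < s) (hs' : 0 < s') (hss : max s s' ≤ s'') (hηs'' : η ≤ s'')
    (Gj Gj' : Kernel P j) (g : SiteField P j ℝ) (hg : ∀ x, |g x| ≤ 1)
    (A : VecField P j ℝ) (g' : SiteField P j ℝ) (A' : VecField P j ℝ)
    (hA : ∀ (μ' : Fin P.d) (x x' : Site P j),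
      |dAdjKernel η⁻¹ μ' Gj x x'| ≤ C₁ * s ^ (1 - (P.d : ℝ)) * Real.exp (-(δ * s⁻¹ * (η * Site.tdist x x'))))
    (hA' : ∀ (μ : Fin P.d) (x x' : Site P j),
      |dAdjKernel η⁻¹ μ Gj' x' x| ≤ C₂ * s' ^ (1 - (P.d : ℝ)) * Real.exp (-(δ * s'⁻¹ * (η * Site.tdist x x'))))
    (hB : ∀ x x' : Site P j, |Gj x x'| ≤ C₃ * s ^ (2 - (P.d : ℝ)) * Real.exp (-(δ * s⁻¹ * (η * Site.tdist x x'))))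
    (hB' : ∀ (μ μ' : Fin P.d) (x x' : Site P j),
      |d2Kernel η⁻¹ μ' μ Gj' x' x| ≤ C₄ * s' ^ (-(P.d : ℝ)) * Real.exp (-(δ * s'⁻¹ * (η * Site.tdist x x'))))
    (x'' : Site P j)
    (hleg : ∀ (μ' ν : Fin P.d) (z z' : Site P j), ‖pdiff η⁻¹ ν (legFn g' A' μ') z - pdiff η⁻¹ ν (legFn g' A' μ') z'‖ ≤
      C₅ * (η * Site.tdist z z') ^ α * Real.exp (-(δ * s''⁻¹ * (η * ((min (Site.tdist z x'') (Site.tdist z' x'') : ℕ) : ℝ)))))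
    {M M'' : ℕ} (hM : 0 < M) :
    |curly2 η τ Gj Gj' g A (fun μ' x x' => remFwd η⁻¹ (legFn g' A' μ') x x')| ≤
      8 * P.d * |τ| * C₅ * Real.exp (δ / 2) * (2 / δ + 8 / δ ^ 2) *
        (C₁ * C₂ * (s ^ (1 - (P.d : ℝ)) * s' ^ (1 - (P.d : ℝ))) + C₃ * C₄ * (s ^ (2 - (P.d : ℝ)) * s' ^ (-(P.d : ℝ)))) *
        (min s s' * (min s s') ^ α) *
        ∑ c ∈ cubes P j M, ∑ c' ∈ cubes P j M, ((M : ℝ) * η) ^ (2 * P.d) *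
          (supOn (fiber M c : Finset (Site P j)) (fun x => ∑ μ : Fin P.d, |A ⟨x, μ⟩|) *
            (Real.exp (-(δ / 2 * s⁻¹ * (η * (cdist P j M M c c' : ℝ)))) *
              Real.exp (-(δ / 2 * s'⁻¹ * (η * (cdist P j M M c c' : ℝ)))) *
              Real.exp (-(δ / 2 * s''⁻¹ * (η * (cdist P j M M'' c (cubeIdx M'' x'') : ℝ)))))) := by
  have hpt := abs_curly2_le_local η hη hα0 hα1 hC₅ hδ hs hs' hss hηs'' Gj Gj' g hg A g' A' hA hA' hB hB' x'' hleg (τ := τ)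
  have hs'' : 0 < s'' := lt_of_lt_of_le (lt_max_of_lt_left hs) hss
  have hKc0 : 0 ≤ |τ| * (C₁ * C₂ * (s ^ (1 - (P.d : ℝ)) * s' ^ (1 - (P.d : ℝ))) +
      C₃ * C₄ * (s ^ (2 - (P.d : ℝ)) * s' ^ (-(P.d : ℝ)))) := by
    have h := (abs_nonneg _).trans (abs_kerC_le (τ := τ) hA hA' hB hB' ⟨0, P.hd⟩ ⟨0, P.hd⟩ default default)
    exact nonneg_of_mul_nonneg_left h (mul_pos (Real.exp_pos _) (Real.exp_pos _))
  have hm : 0 < min s s' := lt_min hs hs'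
  have hK : 0 ≤ 8 * P.d * |τ| * C₅ * Real.exp (δ / 2) * (2 / δ + 8 / δ ^ 2) *
      (C₁ * C₂ * (s ^ (1 - (P.d : ℝ)) * s' ^ (1 - (P.d : ℝ))) + C₃ * C₄ * (s ^ (2 - (P.d : ℝ)) * s' ^ (-(P.d : ℝ)))) *
      (min s s' * (min s s') ^ α) := by
    have h1 : 0 ≤ 8 * (P.d : ℝ) * C₅ * Real.exp (δ / 2) * (2 / δ + 8 / δ ^ 2) * (min s s' * (min s s') ^ α) := by positivity
    calc (0 : ℝ) ≤ (8 * P.d * C₅ * Real.exp (δ / 2) * (2 / δ + 8 / δ ^ 2) * (min s s' * (min s s') ^ α)) *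
        (|τ| * (C₁ * C₂ * (s ^ (1 - (P.d : ℝ)) * s' ^ (1 - (P.d : ℝ))) + C₃ * C₄ * (s ^ (2 - (P.d : ℝ)) * s' ^ (-(P.d : ℝ))))) :=
          mul_nonneg h1 hKc0
      _ = _ := by ring
  have hloc := sum_sum_le_cubes hM hη.le (fun x => ∑ μ : Fin P.d, |A ⟨x, μ⟩|)
    (fun x => Finset.sum_nonneg fun μ _ => abs_nonneg _)
    (fun x x' => Real.exp (-(δ / 2 * s⁻¹ * (η * Site.tdist x x'))) * Real.exp (-(δ / 2 * s'⁻¹ * (η * Site.tdist x x'))) *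
      Real.exp (-(δ / 2 * s''⁻¹ * (η * Site.tdist x x''))))
    (fun x x' => by positivity)
    (fun c c' => Real.exp (-(δ / 2 * s⁻¹ * (η * (cdist P j M M c c' : ℝ)))) *
      Real.exp (-(δ / 2 * s'⁻¹ * (η * (cdist P j M M c c' : ℝ)))) *
      Real.exp (-(δ / 2 * s''⁻¹ * (η * (cdist P j M M'' c (cubeIdx M'' x'') : ℝ)))))
    (fun x x' => mul_le_mul (mul_le_mul (exp_tdist_le_exp_cdist (by positivity) hη.le M M x x')
      (exp_tdist_le_exp_cdist (by positivity) hη.le M M x x') (by positivity) (by positivity))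
      (exp_tdist_le_exp_cdist (by positivity) hη.le M M'' x x'') (by positivity) (by positivity))
  have hre : (∑ x : Site P j, ∑ x' : Site P j, η ^ (2 * P.d) *
      ((∑ μ : Fin P.d, |A ⟨x, μ⟩|) * (Real.exp (-(δ / 2 * s⁻¹ * (η * Site.tdist x x'))) *
        Real.exp (-(δ / 2 * s'⁻¹ * (η * Site.tdist x x')))) * Real.exp (-(δ / 2 * s''⁻¹ * (η * Site.tdist x x''))))) =
      ∑ x : Site P j, ∑ x' : Site P j, η ^ (2 * P.d) *
        ((∑ μ : Fin P.d, |A ⟨x, μ⟩|) * (Real.exp (-(δ / 2 * s⁻¹ * (η * Site.tdist x x'))) *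
          Real.exp (-(δ / 2 * s'⁻¹ * (η * Site.tdist x x'))) * Real.exp (-(δ / 2 * s''⁻¹ * (η * Site.tdist x x''))))) :=
    Finset.sum_congr rfl fun x _ => Finset.sum_congr rfl fun x' _ => by ring
  rw [hre] at hpt
  exact hpt.trans (mul_le_mul_of_nonneg_left hloc hK)

end Curly326

end

end Literature.MathematicalPhysics.QuantumFieldTheory.Balaban1983to89.B3Ineq326CurlyCubes
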